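import Literature.ComputerArithmetic.Shewchuk1997.Compress
import Mathlib.Tactic.Linarith
import Mathlib.Tactic.Positivity
import Mathlib.Tactic.Ring
import Mathlib.Tactic.NormNum
import Mathlib.Tactic.FieldSimp

/-!
# Shewchuk's staircase `1 + ε + ε² + ⋯ + ε^k` is a COMPRESS fixed point under round-to-even,
# in every precision and every length — the sharp ulp-form bound is attained (new work)

New work of the certified-arithmetic venture (ENGINES group: shared numerical engines serving
client cells; rigour lives in the verifiers; every published number belongs to a client cell's
ledger, not to the engines group).  Line: the error of the largest component of COMPRESS
[Shewchuk1997, §2.7 Theorem 23 and the conjecture on p. 333].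

Shewchuk (p. 333) conjectures that the largest component `hₙ` of `h = COMPRESS(e)` approximates
`Σ e` with an error below the supremum of the family `1 + ½ulp(1) + ½²ulp(1)ulp(½ulp(1)) + ⋯`
(`= 1 + ε + ε² + ⋯`, `ε = 2^-p`), adding in parentheses that these expansions "cannot be further
compressed".  The tree's sharp bound (`CompressSharpStair.lean`, `CompressCarryBound.lean`,
`CompressTopError.lean`) is `|Σ e − hₙ| ≤ ulp(hₙ)/2 · (1 + ε + ⋯ + ε^(k−1))` for an output with `k`
lower components, with sharpness witnessed there by ONE evaluation (`p = 4`, `k = 2`).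

THIS FILE proves the parenthetical claim and the attainment in general:

* `compress_eq_self_of_isChain` — a generic replay lemma: if `fl 0 = 0` and every pair of adjacent
  components `a` (smaller) `b` (larger) of `e` satisfies `fl(b + a) = b`, `fl a = a`, `a ≠ 0`, then
  `compress fl e = e` (both traversals of COMPRESS meet exactly the adjacent sums; FAST-TWO-SUM's
  roundoff is the smaller addend).  Proved from two structural inductions
  (`compressDown_of_isChain`, `compressUp_of_isChain`).
* `compress_staircase_roundTiesEven` — for every precision `p ≥ 2`, every `emin ≤ e₀` and every
  `k`, the staircase `⟨2^e₀, 2^(e₀+p), …, 2^(e₀+kp)⟩` (Shewchuk's family scaled by `2^(e₀+kp)`) is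
  returned UNCHANGED by COMPRESS run with the tree's model `roundTiesEven p emin` of IEEE
  round-to-nearest-even: each sum `2^m + 2^(m−p)` is the midpoint of `2^m` and its successor and the
  even significand `2^(p−1)` wins (`roundTiesEven_pow_add_half_ulp`, from the printed tie rule
  `roundTiesEven_of_tie`).
* `staircase_attains_ulp_form` — its largest component misses the sum by EXACTLY
  `ulp(hₙ)/2 · (1 + ε + ⋯ + ε^(k−1))`: the sharp bound is attained for every `p ≥ 2` and every
  number `k` of lower components (`staircase_compress_reverse` puts it in the shape
  `(compress fl e).reverse = hₙ :: t`, `t.length = k`, used by the bound files).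
* `staircase_isFloat`, `staircase_isExpansion` — the staircase is a nonoverlapping expansion of
  floats, i.e. a legitimate input of Theorem 23.

HONEST FRAMING.  Under roundTiesToAway the staircase is NOT a fixed point (`2^m + 2^(m−p)` rounds up),
and the companion files `CompressRelativeErrorTiesAway*.lean` show that for that tie rule other fixed
points exceed the RELATIVE reading `2^-p·|Σ e|` of the conjecture; for round-to-even the relative
reading remains open.  Nothing here is specific to binary64: `p`, `emin`, `e₀`, `k` are parameters.
-/

namespace Summit.Ventures.CertifiedArithmetic.Expansions

open Literature.ComputerArithmetic.JeannerodRump2018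
open Literature.ComputerArithmetic.BoldoJeannerodMelquiondMuller2023 hiding twoSum twoSum_fst
open Literature.ComputerArithmetic.Shewchuk1997

variable {p : ℕ} {emin : ℤ} {fl : ℚ → ℚ}

/-! ### Generic replay: COMPRESS returns a chain of "absorbing" adjacent pairs unchanged -/

/-- Downward traversal (Lines 1–9) along a chain, components LARGEST first after the accumulator
`Q`: if each step has `fl(Q + x) = Q`, `fl x = x`, `x ≠ 0`, then FAST-TWO-SUM returns `(Q, x)`, `Q` is
emitted and `x` becomes the accumulator; so the emitted list is the input without its last element
and the final accumulator is that last element.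
[cite: Shewchuk1997, §2.7 p. 332 (COMPRESS Lines 1–9), §2.3 Theorem 6 (FAST-TWO-SUM)] -/
theorem compressDown_of_isChain (h0 : fl 0 = 0) : ∀ (l : List ℚ) (Q : ℚ),
    List.IsChain (fun a b => fl (a + b) = a ∧ fl b = b ∧ b ≠ 0) (Q :: l) →
      (compressDown fl Q l).1 = (Q :: l).dropLast ∧ (Q :: l).getLast? = some (compressDown fl Q l).2
  | [], Q, _ => by simp
  | x :: xs, Q, h => by
    obtain ⟨⟨hQx, hx, hx0⟩, hrest⟩ := List.isChain_cons_cons.mp h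
    have hfts : fastTwoSum fl Q x = (Q, x) := by simp [fastTwoSum, hQx, h0, hx]
    obtain ⟨ih1, ih2⟩ := compressDown_of_isChain h0 xs x hrest
    rw [compressDown_cons_of_ne_zero (by rw [hfts]; exact hx0), hfts]
    dsimp only
    rw [ih1]
    exact ⟨by simp [List.dropLast_cons_cons], by simpa using ih2⟩

/-- Upward traversal (Lines 10–16) along a chain, components SMALLEST first after the accumulator
`Q`: if each step has `fl(g + Q) = g`, `fl Q = Q`, `Q ≠ 0`, then FAST-TWO-SUM returns `(g, Q)`, `Q` is
emitted and `g` becomes the accumulator; the output is the input.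
[cite: Shewchuk1997, §2.7 p. 332 (COMPRESS Lines 10–16), §2.3 Theorem 6] -/
theorem compressUp_of_isChain (h0 : fl 0 = 0) : ∀ (gs : List ℚ) (Q : ℚ),
    List.IsChain (fun a b => fl (b + a) = b ∧ fl a = a ∧ a ≠ 0) (Q :: gs) →
      compressUp fl Q gs = Q :: gs
  | [], Q, _ => by simp
  | g :: gs, Q, h => by
    obtain ⟨⟨hgQ, hQ, hQ0⟩, hrest⟩ := List.isChain_cons_cons.mp h
    have hfts : fastTwoSum fl g Q = (g, Q) := by simp [fastTwoSum, hgQ, h0, hQ]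
    rw [compressUp_cons_of_ne_zero (by rw [hfts]; exact hQ0), hfts]
    dsimp only
    rw [compressUp_of_isChain h0 gs g hrest]

/-- **Generic replay lemma.**  Let `e` be listed smallest component first.  If `fl 0 = 0` and every
adjacent pair `a` (smaller), `b` (larger) satisfies `fl(b + a) = b` (the larger absorbs the smaller),
`fl a = a` and `a ≠ 0`, then `COMPRESS(e) = e`: the downward sweep emits every component but the
smallest, which becomes the bottom carry, and the upward sweep re-emits everything.
[cite: Shewchuk1997, §2.7 p. 332 (COMPRESS)] -/
theorem compress_eq_self_of_isChain (h0 : fl 0 = 0) {e : List ℚ}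
    (he : List.IsChain (fun a b => fl (b + a) = b ∧ fl a = a ∧ a ≠ 0) e) : compress fl e = e := by
  cases e with
  | nil => simp [compress]
  | cons x xs =>
    cases hrev : (x :: xs).reverse with
    | nil => simp at hrev
    | cons em rest =>
      have hcomp : compress fl (x :: xs) =
          compressUp fl (compressDown fl em rest).2 (compressDown fl em rest).1.reverse := by
        simp only [compress, hrev]
      have hdown : List.IsChain (fun a b => fl (a + b) = a ∧ fl b = b ∧ b ≠ 0) (em :: rest) := by
        rw [← hrev]; exact List.isChain_reverse.mpr he
      obtain ⟨h1, h2⟩ := compressDown_of_isChain h0 rest em hdown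
      have htail : (compressDown fl em rest).1.reverse = xs := by
        rw [h1, ← hrev, List.dropLast_reverse, List.reverse_reverse, List.tail_cons]
      have hhead : (compressDown fl em rest).2 = x := by
        rw [← hrev, List.getLast?_reverse] at h2
        simpa using h2.symm
      rw [hcomp, htail, hhead]
      exact compressUp_of_isChain h0 xs x he

/-! ### Round-to-even at the staircase ties -/

/-- `ulp` on a binade: `2^m ≤ |t| < 2^(m+1)` in the normal range (`m − p + 1 ≥ emin`) gives
`ulp(t) = 2^(m−p+1)`. [cite: BoldoEtAl2023, §2.1 Def. 2.4 (p. 213–214)] -/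
private theorem ulp_eq_of_binade {t : ℚ} {m : ℤ} (hm : emin ≤ m - p + 1) (h1 : (2 : ℚ) ^ m ≤ |t|)
    (h2 : |t| < (2 : ℚ) ^ (m + 1)) : ulp p emin t = (2 : ℚ) ^ (m - p + 1) := by
  have hpos : 0 < |t| := lt_of_lt_of_le (zpow_pos (by norm_num) _) h1
  have ht0 : t ≠ 0 := abs_pos.mp hpos
  have hlo : m ≤ Int.log 2 |t| :=
    (Int.zpow_le_iff_le_log (b := 2) (by norm_num) hpos).mp (by exact_mod_cast h1)
  have hhi : Int.log 2 |t| < m + 1 :=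
    (Int.lt_zpow_iff_log_lt (b := 2) (by norm_num) hpos).mp (by exact_mod_cast h2)
  have hlog : Int.log 2 |t| = m := le_antisymm (by omega) hlo
  rw [ulp_of_ne_zero ht0, hlog, max_eq_right hm]

/-- **The staircase tie goes to even.**  For `p ≥ 2` and `2^m` in the normal range, `2^m + 2^(m−p)`
is the midpoint of the float `2^m` (even significand `2^(p−1)`) and its successor `2^m + 2^(m−p+1)`
(odd significand `2^(p−1) + 1`); the printed ties-to-even rule returns `2^m`.
[cite: BoldoEtAl2023, §2.2 (p. 212, "the one whose integral significand is even");
Shewchuk1997, §2.7 p. 333 ("cannot be further compressed")] -/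
theorem roundTiesEven_pow_add_half_ulp (hp : 2 ≤ p) {m : ℤ} (hm : emin ≤ m - p + 1) :
    roundTiesEven p emin ((2 : ℚ) ^ m + (2 : ℚ) ^ (m - p)) = (2 : ℚ) ^ m := by
  obtain ⟨q, rfl⟩ : ∃ q, p = q + 1 := ⟨p - 1, by omega⟩
  have hq : 1 ≤ q := by omega
  have h2 : (2 : ℚ) ≠ 0 := by norm_num
  -- `u = 2^(m−q)` is the ulp, `2^m = 2^q·u`, `2^(m−p) = u/2`
  have hmu : (2 : ℚ) ^ m = 2 ^ q * (2 : ℚ) ^ (m - q) := by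
    rw [← zpow_natCast, ← zpow_add₀ h2]; congr 1; ring
  have hhalf : (2 : ℚ) ^ (m - ((q + 1 : ℕ) : ℤ)) = (2 : ℚ) ^ (m - q) / 2 := by
    rw [show m - ((q + 1 : ℕ) : ℤ) = m - q - 1 by push_cast; ring, zpow_sub_one₀ h2, div_eq_mul_inv]
  have hu : (0 : ℚ) < (2 : ℚ) ^ (m - q) := zpow_pos (by norm_num) _
  have hY : (2 : ℚ) ≤ 2 ^ q := by
    calc (2 : ℚ) = 2 ^ 1 := (pow_one 2).symm
      _ ≤ 2 ^ q := pow_le_pow_right₀ (by norm_num) hq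
  have htpos : (0 : ℚ) < (2 : ℚ) ^ m + (2 : ℚ) ^ (m - ((q + 1 : ℕ) : ℤ)) :=
    add_pos (zpow_pos (by norm_num) _) (zpow_pos (by norm_num) _)
  -- the ulp of the midpoint
  have hulp : ulp (q + 1) emin ((2 : ℚ) ^ m + (2 : ℚ) ^ (m - ((q + 1 : ℕ) : ℤ))) = (2 : ℚ) ^ (m - q) := by
    have h := ulp_eq_of_binade (p := q + 1) (emin := emin) (t := (2 : ℚ) ^ m + (2 : ℚ) ^ (m - ((q + 1 : ℕ) : ℤ)))
      (m := m) (by push_cast at hm ⊢; linarith) (by rw [abs_of_pos htpos, hhalf]; linarith)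
      (by rw [abs_of_pos htpos, hhalf, zpow_add_one₀ h2, hmu]; nlinarith)
    rwa [show m - ((q + 1 : ℕ) : ℤ) + 1 = m - q by push_cast; ring] at h
  have hfloor : ⌊((2 : ℚ) ^ m + (2 : ℚ) ^ (m - ((q + 1 : ℕ) : ℤ))) /
      ulp (q + 1) emin ((2 : ℚ) ^ m + (2 : ℚ) ^ (m - ((q + 1 : ℕ) : ℤ)))⌋ = 2 ^ q := by
    rw [hulp, Int.floor_eq_iff, hhalf, hmu]
    push_cast
    constructor
    · rw [le_div_iff₀ hu]; linarith
    · rw [div_lt_iff₀ hu]; linarith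
  have htie : (2 : ℚ) ^ m + (2 : ℚ) ^ (m - ((q + 1 : ℕ) : ℤ)) -
      (⌊((2 : ℚ) ^ m + (2 : ℚ) ^ (m - ((q + 1 : ℕ) : ℤ))) /
          ulp (q + 1) emin ((2 : ℚ) ^ m + (2 : ℚ) ^ (m - ((q + 1 : ℕ) : ℤ)))⌋ : ℚ) *
        ulp (q + 1) emin ((2 : ℚ) ^ m + (2 : ℚ) ^ (m - ((q + 1 : ℕ) : ℤ))) =
      ((⌊((2 : ℚ) ^ m + (2 : ℚ) ^ (m - ((q + 1 : ℕ) : ℤ))) /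
          ulp (q + 1) emin ((2 : ℚ) ^ m + (2 : ℚ) ^ (m - ((q + 1 : ℕ) : ℤ)))⌋ : ℚ) + 1) *
        ulp (q + 1) emin ((2 : ℚ) ^ m + (2 : ℚ) ^ (m - ((q + 1 : ℕ) : ℤ))) -
      ((2 : ℚ) ^ m + (2 : ℚ) ^ (m - ((q + 1 : ℕ) : ℤ))) := by
    rw [hfloor, hulp, hhalf, hmu]; push_cast; ring
  have heven : Even ⌊((2 : ℚ) ^ m + (2 : ℚ) ^ (m - ((q + 1 : ℕ) : ℤ))) /
      ulp (q + 1) emin ((2 : ℚ) ^ m + (2 : ℚ) ^ (m - ((q + 1 : ℕ) : ℤ)))⌋ := by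
    rw [hfloor]; exact (Int.even_pow' (by omega)).mpr even_two
  rw [roundTiesEven_of_tie htie, if_pos heven, hfloor, hulp, hmu]
  push_cast
  ring

/-! ### The staircase `2^e₀, 2^(e₀+p), …, 2^(e₀+kp)` -/

/-- The staircase components are floats (significand `1`). [cite: Shewchuk1997, §2.1 p. 309] -/
theorem staircase_isFloat (hp : 1 ≤ p) {e₀ : ℤ} (he : emin ≤ e₀) (k : ℕ) :
    ∀ x ∈ (List.range (k + 1)).map (fun j : ℕ => (2 : ℚ) ^ (e₀ + (j : ℤ) * p)), IsFloat p emin x := by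
  intro x hx
  obtain ⟨j, -, rfl⟩ := List.mem_map.mp hx
  have hj : (0 : ℤ) ≤ (j : ℤ) * p := by positivity
  exact ⟨1, e₀ + (j : ℤ) * p, by rw [abs_one]; exact one_lt_pow₀ (by norm_num) (by omega),
    by linarith, by simp⟩

/-- The staircase is a nonoverlapping expansion, smallest first (even strongly so: consecutive
components are `p` binades apart). [cite: Shewchuk1997, §2.1 p. 309 (nonoverlapping)] -/
theorem staircase_isExpansion (hp : 1 ≤ p) (e₀ : ℤ) (k : ℕ) :
    IsExpansion 1 ((List.range (k + 1)).map (fun j : ℕ => (2 : ℚ) ^ (e₀ + (j : ℤ) * p))) := by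
  refine List.pairwise_map.mpr (List.pairwise_lt_range.imp ?_)
  intro i j hij
  have hp0 : (0 : ℤ) < p := by exact_mod_cast hp
  have hlt : (i : ℤ) * p < (j : ℤ) * p := Int.mul_lt_mul_of_pos_right (by exact_mod_cast hij) hp0
  refine ⟨e₀ + (j : ℤ) * p, ⟨1, by simp⟩, ?_⟩
  rw [one_mul, abs_of_pos (zpow_pos (by norm_num) _)]
  exact zpow_lt_zpow_right₀ (by norm_num) (by linarith)

/-- Sanity instance (an evaluation, not a claim of the paper): `p = 4`, `e₀ = 0`, `k = 2` is the
staircase `⟨1, 16, 256⟩` of the sharpness example in `CompressTopError.lean`.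
[cite: Shewchuk1997, §2.7 p. 333] -/
example : (List.range (2 + 1)).map (fun j : ℕ => (2 : ℚ) ^ ((0 : ℤ) + (j : ℤ) * (4 : ℕ))) = [1, 16, 256] := by
  simp [List.range_succ]

/-- **Shewchuk's staircase cannot be further compressed (round-to-even), every precision and length.**
For `p ≥ 2`, `emin ≤ e₀` and every `k`, COMPRESS run with `roundTiesEven p emin` returns
`⟨2^e₀, 2^(e₀+p), …, 2^(e₀+kp)⟩` unchanged. [cite: Shewchuk1997, §2.7 p. 333 ("Note that
1 + ½ulp(1) + ⋯ cannot be further compressed"); BoldoEtAl2023, §2.2 (ties-to-even)] -/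
theorem compress_staircase_roundTiesEven (hp : 2 ≤ p) {e₀ : ℤ} (he : emin ≤ e₀) (k : ℕ) :
    compress (roundTiesEven p emin) ((List.range (k + 1)).map (fun j : ℕ => (2 : ℚ) ^ (e₀ + (j : ℤ) * p))) =
      (List.range (k + 1)).map (fun j : ℕ => (2 : ℚ) ^ (e₀ + (j : ℤ) * p)) := by
  have hp1 : 1 ≤ p := by omega
  refine compress_eq_self_of_isChain (roundTiesEven_eq_self hp1 (isFloat_zero p emin))
    ((List.isChain_map _).mpr ((List.isChain_range_succ _ k).mpr fun j _ => ?_))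
  have hj : (0 : ℤ) ≤ (j : ℤ) * p := by positivity
  have hexp : e₀ + (j : ℤ) * p = e₀ + ((j.succ : ℕ) : ℤ) * p - p := by push_cast; ring
  have hF : IsFloat p emin ((2 : ℚ) ^ (e₀ + (j : ℤ) * p)) :=
    ⟨1, e₀ + (j : ℤ) * p, by rw [abs_one]; exact one_lt_pow₀ (by norm_num) (by omega),
      by linarith, by simp⟩
  refine ⟨?_, roundTiesEven_eq_self hp1 hF, (zpow_pos (by norm_num) _).ne'⟩
  rw [hexp]
  exact roundTiesEven_pow_add_half_ulp hp (by push_cast; linarith)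

/-- The output in the shape used by the bound files: `(compress fl e).reverse = hₙ :: t` with
`hₙ = 2^(e₀+kp)` and `t` the `k` lower components. [cite: Shewchuk1997, §2.7 Theorem 23] -/
theorem staircase_compress_reverse (hp : 2 ≤ p) {e₀ : ℤ} (he : emin ≤ e₀) (k : ℕ) :
    (compress (roundTiesEven p emin)
        ((List.range (k + 1)).map (fun j : ℕ => (2 : ℚ) ^ (e₀ + (j : ℤ) * p)))).reverse =
      (2 : ℚ) ^ (e₀ + (k : ℤ) * p) ::
        ((List.range k).map (fun j : ℕ => (2 : ℚ) ^ (e₀ + (j : ℤ) * p))).reverse := by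
  rw [compress_staircase_roundTiesEven hp he k, List.range_succ, List.map_append, List.reverse_append]
  simp

/-- List sum over `range` as a `Finset` sum (bookkeeping). [cite: Shewchuk1997, §2.7] -/
private theorem sum_map_range (f : ℕ → ℚ) : ∀ k : ℕ,
    ((List.range k).map f).sum = (Finset.range k).sum f
  | 0 => by simp
  | k + 1 => by
    rw [List.range_succ, List.map_append, List.sum_append, Finset.sum_range_succ, sum_map_range f k]
    simp

/-- The geometric identity `Σ_{j<k} 2^(e₀+jp) = 2^(e₀+kp−p) · (1 + ε + ⋯ + ε^(k−1))`, `ε = 2^-p`.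
[cite: Shewchuk1997, §2.7 p. 333] -/
private theorem stair_geom (p : ℕ) (e₀ : ℤ) : ∀ k : ℕ,
    (Finset.range k).sum (fun j : ℕ => (2 : ℚ) ^ (e₀ + (j : ℤ) * p)) =
      (2 : ℚ) ^ (e₀ + (k : ℤ) * p - p) * (Finset.range k).sum (fun i => ((2 : ℚ) ^ p)⁻¹ ^ i)
  | 0 => by simp
  | k + 1 => by
    rw [Finset.sum_range_succ, stair_geom p e₀ k, Finset.sum_range_succ', pow_zero, mul_add, mul_one]
    have h1 : (2 : ℚ) ^ (e₀ + ((k + 1 : ℕ) : ℤ) * p - p) = (2 : ℚ) ^ (e₀ + (k : ℤ) * p) := by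
      congr 1; push_cast; ring
    have h2 : (2 : ℚ) ^ (e₀ + (k : ℤ) * p - p) = (2 : ℚ) ^ (e₀ + (k : ℤ) * p) * ((2 : ℚ) ^ p)⁻¹ := by
      rw [zpow_sub₀ (by norm_num : (2 : ℚ) ≠ 0), zpow_natCast, div_eq_mul_inv]
    rw [h1, h2, Finset.mul_sum, Finset.mul_sum]
    congr 1
    refine Finset.sum_congr rfl fun i _ => ?_
    rw [pow_succ]; ring

/-- **The sharp bound is attained, every `p ≥ 2` and every `k`.**  The largest component
`hₙ = 2^(e₀+kp)` of the (uncompressible) staircase misses the sum by exactly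
`ulp(hₙ)/2 · (1 + ε + ⋯ + ε^(k−1))`, `ε = 2^-p` — the right-hand side of the tree's bound for an
output with `k` lower components. [cite: Shewchuk1997, §2.7 p. 333; BoldoEtAl2023, §2.1 Def. 2.4] -/
theorem staircase_attains_ulp_form {e₀ : ℤ} (he : emin ≤ e₀) (k : ℕ) :
    |((List.range (k + 1)).map (fun j : ℕ => (2 : ℚ) ^ (e₀ + (j : ℤ) * p))).sum -
        (2 : ℚ) ^ (e₀ + (k : ℤ) * p)| =
      ulp p emin ((2 : ℚ) ^ (e₀ + (k : ℤ) * p)) / 2 *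
        (Finset.range k).sum (fun i => ((2 : ℚ) ^ p)⁻¹ ^ i) := by
  rw [List.sum_range_succ, add_sub_cancel_right, sum_map_range, stair_geom,
    abs_of_nonneg (mul_nonneg (zpow_pos (by norm_num) _).le
      (Finset.sum_nonneg fun i _ => pow_nonneg (inv_nonneg.mpr (pow_pos (by norm_num) _).le) _))]
  rcases Nat.eq_zero_or_pos k with rfl | hk
  · simp
  · have hkp : (p : ℤ) ≤ (k : ℤ) * p := by
      have : (1 : ℤ) ≤ k := by exact_mod_cast hk
      nlinarith
    have hulp : ulp p emin ((2 : ℚ) ^ (e₀ + (k : ℤ) * p)) = (2 : ℚ) ^ (e₀ + (k : ℤ) * p - p + 1) :=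
      ulp_eq_of_binade (by linarith) (by rw [abs_of_pos (zpow_pos (by norm_num) _)])
        (by rw [abs_of_pos (zpow_pos (by norm_num) _)]; exact zpow_lt_zpow_right₀ (by norm_num) (by omega))
    rw [hulp, zpow_add_one₀ (by norm_num : (2 : ℚ) ≠ 0)]
    ring

end Summit.Ventures.CertifiedArithmetic.Expansions
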